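import Summits.CriticalPhenomena.PercolationContinuityZ3.Theorems.Transplant.SkelPhiForcedRootKitClauseC
import Summits.CriticalPhenomena.PercolationContinuityZ3.Theorems.Transplant.SkelPhiRootKitClauseG
import HarnessLib

/-!
(R-35)/J12 successor `…C` of `SkelPhiRootBridgeKitsF` (hp-8 g40, 2026-08-23): the forced kit is RE-CENTRED AT THE COLUMN END (p1-g17's `kitClauseFC` /
`kitClause_runXFC/YFC` / `kitClause_frameFC` / `kitClause_rootFrameFC`, binder list lane 03:18:28Z): the fat-prism rows `hkz / hRk· / hΛcyl` (and `hfr / hκ`,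
which only fed them) and the column row `hcol` are GONE (`ctCtr ↦ ctColEnd`, `ψ_ctColEnd_mem_Icc` / `ctColEnd_reach`, SkelPhiForcedColumnPlace); every other
binder and the proof body are verbatim — mentions of those rows below describe the superseded `SkelPhiRootBridgeKitsF`.

# N2 (frames-only node), (S0) kit tier, (F) spine part 5 (hp-8 g39): **THE FORCED KIT CLAUSE OF A BRIDGE-STEP LEVEL FROM THE BRIDGE EVENT AT EVERY
# CENTRE** (`Skelφ.hkits_bridgeFC`) — the (S0) twin of p3-g9's `hkits_bridgeG` (SkelPhiRootKitClauseG §3): `hkits` of p1-g16's assembler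
# `kitsAt_stepAFF` for the one bridge step read in the root frame `rootFrame φ t σ`, from p1-g16's `kitClause_rootFrameFC` (p339650): FAR contacts
# land in the target through the window rim; NEAR contacts get p3-g9's route datum `routeSets_bridge` from the bridge event at accuracy `δ³`.
# Consumed by the (F) face route (`faceRoute_of_inputs4_x/3_y/4_y`'s bridge segment) and by the (R) column's root chain alike.

NON-VACUITY (lead g11 STANDING ORDER 2026-08-23T03:52:56Z (2)(b)): this file only THREADS its window / region / zone rows to p1-g17's re-centred
kit clause (`kitClauseFC` family, whose kept rows `hRg/hΛRg/hzconn/hcz/hDρ/hKCmax` have the witness `Λc := cylBallFin c kz R`, `Rg := Λc`,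
`Rs :=` its graph extent — p1-g17 03:09:30Z / (R-35) (3)); the FULL binder set of the theorems below is instantiated JOINTLY, at the closed terms of
record, by the (F) wrapper `faceHoldsRNQFnLT_frmChoiceAllQ3` (stmt-g20's Face params/glue twins over `KS0.kit0_ok` SkelFrmBChoiceNums p347587,
`hlong_of_atQ3/hlongY_of_atQ3` SkelFrmBChoiceLinks p351172, hp-8's SkelPhiCellsRoomsS/RootRoomsS) — non-vacuity: discharged jointly by that wrapper.
builds on p205010 (kernel theorem, internal audit signed; external expert review pending) — nothing in this file uses p205010; nothing here is a
claim about the open node `SamePDropOfSkeletonFrm₁`.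
Lane `prim-bschramm`, seat `prim-hp-8` (gen 39; junction file shared with the (R) column, typed per hp-8 g39 19:46:40Z); helper file
(`--supports stmt-CriticalPhenomena-4575 --as helper`); F-PORT-JUNCTIONS (hp-8 g37).
Port rule ((S0), p1-g16 19:34:49Z / 19:43:23Z): binders of `hkits_bridgeG` minus `hd1/hD1/hD2/hℓ/hW/hKmax/hR'/hT`, the zone rows `hkn/hΛ`, the
pieces `Pex/hPex`, `hFZ` and the estimates `hzone/hexit`; plus `hdD` and the zone datum's rows `hΛRg/hzconn/hcz` and the fat-prism rows `hkz/hRk/hΛcyl` (discharging `hcol` by `ctColEnd_mem_cylBallFin`); `hbridge` at `1 − δ³`;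
conclusion = the per-level clause of `TStep.KitsAtF`.
* **`hkits_bridgeFC`**.
[cite: KozmaNitzan2024, §4 Lemma 10, Steps III–IV (pp. 19–21), p. 28] [cite: MartineauTassion2017, §4.3 Lemma 4.2]
-/

noncomputable section

open scoped Classical

namespace Summit.CriticalPhenomena.PercolationContinuityZ3.Theorems.Transplant

namespace Skelφ

open MeasureTheory
open Literature.Probability.Percolation Literature.Probability.LatticeModels SimpleGraph KNLevels
open Literature.Barriers.CriticalPhenomena (graphBall graphBall_finite mem_graphBall_self graphBall_mono)
open Skel (winGraph winGraph_adj winGraph_le KitGeom)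
open SkelI (tanOff tanTgt tanTgt_mem)
open Literature.Probability.Percolation.KozmaNitzan.Cells (oth oth_ne eq_oth_of_ne oth_oth)
open ChainPlanar

variable {V : Type} [DecidableEq V] {G : SimpleGraph V} [G.LocallyFinite] {φ : V → Site 2}

/-! ## The bridge-step forced kit clause -/

/-- **THE FORCED KIT CLAUSE OF A BRIDGE-STEP LEVEL FROM THE BRIDGE EVENT AT EVERY CENTRE** (`hkits₁` of the bridge segment at its only step
`k = 0`, level `j`; the (S0) twin of p3-g9's `hkits_bridgeG`): the window is the root frame `rootFrame φ t σ` around `w₀` (radius `R`), the level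
box is `[B₀lo − j, B₀hi + j]`, the region `Dr ⊇ Win([regionLo, regionHi])` carries the subbox weighting `Wt`, the target
`T ⊇ Win([core1Lo, core1Hi]) ∪ (far part of the level)`; the zone datum `Λc c kz` at the kit centres; input at every centre `c`: the BRIDGE event
at accuracy `δ³` — region `Qb c ⊆ B(c, R_b)` read inside `rootFrame c ± pr`, piece `Fb c ⊆ Qb c` read inside `rootFrame c + [dlo, dhi]` (route datum
by p3-g9's `routeSets_bridge`). No zone estimate, no exit pieces ((S0)).
[cite: KozmaNitzan2024, §4 Lemma 10 (pp. 17–21), p. 28] [cite: MartineauTassion2017, §4.3 Lemma 4.2] [this work] -/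
theorem hkits_bridgeFC [Countable V] (hlipφ : Lip G φ) (hstep : Steps G φ) {Δ : ℕ} (hΔ : ∀ v, G.degree v ≤ Δ) {q : unitInterval} {δ : ℝ} (hδ : 0 < δ)
    -- the root frame and the bridge frame
    (t : V) {σ : ℤ} (hσ : σ = 1 ∨ σ = -1) (B : BridgePrm) {j : ℕ} {w₀ : V} {R r Rb : ℕ}
    -- kit constants
    (P : ApronPrm) {Mz Rs KCmax rs cS cU : ℕ} (hPN : 1 ≤ P.N) (hA : P.A = (Mz : ℤ) + 2)
    (hdD : P.d + 2 ≤ shellD P) (hDρ : Rs + 1 ≤ shellD P) (hKCmax : shellD P + Mz + 1 ≤ KCmax)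
    (hwide : ∀ i, (B.B₀lo - (j : Site 2)) i + 2 * tanOff P.ℓs P.M ≤ (B.B₀hi + (j : Site 2)) i)
    (hdw : ∀ i, (B.B₀lo - (j : Site 2)) i + (P.d + 2 : ℕ) ≤ (B.B₀hi + (j : Site 2)) i)
    (hDw : ∀ i, (B.B₀lo - (j : Site 2)) i + ((shellD P + 1 + P.d + KCmax + Rs : ℕ) : ℤ) ≤ (B.B₀hi + (j : Site 2)) i)
    (hT : (shellD P : ℤ) + KCmax + Rs ≤ tanOff P.ℓs P.M)
    (hr₀ : P.N * (tanOff P.ℓs P.M + 2) + P.N * P.d + (KCmax + Rs) ≤ P.r₀) (hR : P.r₀ ≤ R)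
    (hrs : 1 + (P.N * (tanOff P.ℓs P.M + 2) + P.N * P.d + (KCmax + Rs)) ≤ rs)
    (hcS : (P.N + 1) * (tanOff P.ℓs P.M + 1) + (P.N + 1) * P.d + (KCmax + 1) + cU ≤ cS)
    -- the reach of the kit centre: inside the `R′`-enlargement, and `B(w₀, R − r)` with `R_b ≤ r ≤ R`
    (hE : j + (P.N * (tanOff P.ℓs P.M + 1) + P.N * P.d + KCmax) ≤ B.R')
    (hreach : r + (P.N * (tanOff P.ℓs P.M + 1) + P.N * P.d + KCmax) ≤ P.r₀) (hr : Rb ≤ r) (hrR : r ≤ R)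
    -- the short region and the zone datum at the kit centres (inside `Rg`, connected from the centre inside itself, containing the centre
    -- and the fat-prism zone box of record `cylBallFin c kz Rk`, `Rk ≥ cylRadMax types kz (2·KCmax)` — whence the forced column's end)
    (Rg : V → Finset V) (hRg : ∀ c, ∀ u ∈ Rg c, u ∈ graphBall G c Rs) (hRgcard : ∀ c, (Rg c).card ≤ cU) (hcU1 : 1 ≤ cU)
    (Λc : V → ℕ → Finset V) (kz : ℕ) (hΛRg : ∀ c, Λc c kz ⊆ Rg c) (hzconn : ∀ c, ∀ s ∈ Λc c kz, PathIn G (↑(Λc c kz) : Set V) c s)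
    (hcz : ∀ c, c ∈ Λc c kz)


    -- the bridge stride at every centre: region, piece, readings in the root frame
    (Qb Fb : V → Finset V)
    (hQb : ∀ c, ∀ w ∈ Qb c, w ∈ graphBall G c Rb ∧
      rootFrame φ t σ w ∈ Finset.Icc (rootFrame φ t σ c - ((B.pr : ℕ) : Site 2)) (rootFrame φ t σ c + ((B.pr : ℕ) : Site 2)))
    (hFb : ∀ c, ∀ w ∈ Fb c, w ∈ Qb c ∧ rootFrame φ t σ w ∈ Finset.Icc (rootFrame φ t σ c + B.dlo) (rootFrame φ t σ c + B.dhi))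
    -- the level's source/support, the weighting on the region, the target
    (kk : ℕ) (o : V) (Sfin : Finset V) {Wt : Sym2 V → unitInterval} {Dr T : Finset V} (hWD : IsSubbox (winGraph G w₀ R) Wt q Dr)
    (hPD : Win G (rootFrame φ t σ) w₀ (Finset.Icc B.regionLo B.regionHi) R ⊆ Dr)
    (hXD : winLevel G (rootFrame φ t σ) w₀ R B.B₀lo B.B₀hi j ⊆ Dr)
    (hPT : Win G (rootFrame φ t σ) w₀ (Finset.Icc B.core1Lo B.core1Hi) R ⊆ T)
    (hfarT : ∀ v ∈ winLevel G (rootFrame φ t σ) w₀ R B.B₀lo B.B₀hi j, v ∉ graphBall G w₀ (R - P.r₀) → v ∈ T)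
    {N : ℕ} (hN : kk * (Δ + 1) ^ (2 * rs) ≤ N) (hk : (1 - (q : ℝ) ^ (1 + Δ * cS + cS * cU)) ^ kk ≤ δ)
    -- THE INPUT AT EVERY CENTRE: the bridge event at accuracy `δ³`
    (hbridge : ∀ c, 1 - δ ^ 3 < (bondPercolation G q).real (linkIn (↑(Qb c) : Set V) (Λc c kz) (Fb c))) :
    ∃ (σ' : SData V) (S : Finset V),
      SHyp (winLData G (rootFrame φ t σ) w₀ R B.B₀lo B.B₀hi o Sfin) j σ' ∧ σ'.N ≤ N ∧ (1 - (q : ℝ) ^ σ'.sB) ^ σ'.k ≤ δ ∧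
      S ⊆ Dr ∧ (∀ x ∈ σ'.K, σ'.face x ⊆ S) ∧ RelayClause (winLData G (rootFrame φ t σ) w₀ R B.B₀lo B.B₀hi o Sfin) Wt j σ' S T Dr δ := by
  set ψ := rootFrame φ t σ with hψ
  set SF := rootSideU (φ := φ) t hσ (B.B₀lo - (j : Site 2)) (B.B₀hi + (j : Site 2)) with hSF
  have hKeq : winLevel G ψ w₀ R B.B₀lo B.B₀hi j = Win G ψ w₀ (Finset.Icc (B.B₀lo - (j : Site 2)) (B.B₀hi + (j : Site 2))) R := rfl
  -- the frame facts used for the reach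
  have hlip : Lip G ψ := lip_rootFrame hlipφ t hσ
  have hq : QStepsN G ψ P.N := (qStepsN_of_steps (steps_rootFrame hstep t hσ)).mono hPN
  have hU1 : (1 : ℤ) ≤ 1 := le_rfl
  have haff : ∀ (i : Fin 2) (σ₀ : ℤˣ), (SF i σ₀).IsAffine 1 ((fun _ _ => (1 : ℤ)) i σ₀) := fun i σ₀ => by
    rw [hSF]; exact rootSideU_isAffine t hσ _ _ i σ₀
  have hC : ∀ (i : Fin 2) (σ₀ : ℤˣ), ((1 : ℕ) : ℤ) ≤ (fun _ _ => (1 : ℤ)) i σ₀ := fun _ _ => by simp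
  have hU : (1 : ℤ) ≤ ((0 + 1 : ℕ) : ℤ) * (1 : ℕ) := by simp
  have hA' : P.A = ((Mz + 1 : ℕ) : ℤ) * 1 + 1 := by rw [hA]; push_cast; ring
  have hKCmax' : (shellD P + Mz + 1) * (0 + 1) ≤ KCmax := by simpa using hKCmax
  have hKC := hKC_of_affine SF haff hU1 P (le_refl 1) hC hU hA' hKCmax'
  refine kitClause_rootFrameFC hlipφ hstep hΔ hδ t hσ P hPN hA hdD hDρ hKCmax hwide hdw hDw hT hr₀ hR hrs hcS Rg hRg hRgcard hcU1 Λc kz hΛRg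
    hzconn hcz kk o Sfin hXD hN hk (fun x hx hfar => ?_) (fun x hx hnear => ?_)
  · -- FAR: the inner neighbour lies in the level and outside `B(w₀, R − r₀)`
    refine hfarT _ ?_ hfar
    have h := inNbr_spec (G := G) (φ := ψ) (by rw [hKeq] at hx; exact hx)
    rw [hKeq]
    exact (mem_Win G ψ).2 ⟨h.2.1, h.2.2⟩
  · -- NEAR: the bridge route datum at the kit centre (the zone-box disjunction's second branch)
    refine Or.inr ?_
    have hx' : x ∈ outerBoundary (winGraph G w₀ R) (Win G ψ w₀ (Finset.Icc (B.B₀lo - (j : Site 2)) (B.B₀hi + (j : Site 2))) R) := by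
      rw [hKeq] at hx; exact hx
    set c := ctColEnd G SF P w₀ R x with hc
    -- the centre's frame image and window position
    have hcI : ψ c ∈ Finset.Icc (B.B₀lo - ((B.R' : ℕ) : Site 2)) (B.B₀hi + ((B.R' : ℕ) : Site 2)) :=
      ψ_ctColEnd_mem_Icc SF hlip hq hstep hwide (fun i σ₀ z h1 h2 => hKC i σ₀ z h1) hE hx
    have hcw : c ∈ graphBall G w₀ (R - r) := by
      have hd := ctColEnd_reach SF hlip hq hstep hwide (fun i σ₀ z h1 h2 => hKC i σ₀ z h1) hx'
      have h := BoxProdZ2.mem_graphBall_add G hnear hd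
      exact graphBall_mono G _ (by omega) h
    obtain ⟨Qt, Ft, hFT, hQD, -, hlt⟩ :=
      routeSets_bridge t σ B hcI hcw hr hrR (hQb c) (hFb c) (Z := ∅) (Finset.disjoint_empty_right _) hPD hPT hWD (hbridge c)
    exact ⟨Qt, Ft, hFT, hQD, hlt.le⟩

end Skelφ

end Summit.CriticalPhenomena.PercolationContinuityZ3.Theorems.Transplant

end
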